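import Summits.ABC.ABC.Theorems.TwistAmplificationSharpModerateLawDeepModuliStationaryPhase

/-!
# Crux `TwistAmplification.SharpModerateLaw` (stmt-ABC-1975), stub `stub_cuspStationaryPhase23` — support file 1/2:
generic inputs and the prime `p = 3`

Line `deep-moduli-cusp-dispersion`, registered stub `stub_cuspStationaryPhase23` (statement `CuspSumBound23` of
`…CuspDispersionTwDefs.lean`): the stationary-phase bound `|S(h₁,h₂;pⁿ)| ≤ 2·p^{n/2}` for the complete cusp sums
`S(h₁,h₂;pⁿ) = Σ_{t ∈ (ℤ/pⁿ)ˣ} e((h₁t² + h₂t³)/pⁿ)` at the two small primes `p ∈ {2, 3}`, `n ≥ 2`, `(h₁,h₂)` not both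
divisible by `p`. This file (1/2) proves the `p = 3` half (registered sub-goal `cuspSumBound23_three_main`), the companion
`…CuspSumBound23.lean` (2/2) the `p = 2` half and the stub. Everything is elementary and reuses the generic machinery of
the landed `p ≥ 5` file `…DeepModuliStationaryPhase.lean` (`DeepModuli.cuspSum_firstStep`, orthogonality
`sum_range_stdAddChar_mul`, rescaling `stdAddChar_mul_eq`, reindexing `sum_range_mul_eq_sum_sum`, and the quadratic Gauss
sum modulo an odd prime `norm_sum_range_quadratic`); throughout `e(x/N)` of an integer `x` is
`ZMod.stdAddChar (N := N) (x : ZMod N)`.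

At `p = 3` the derivative `f′(t) = t(2h₁ + 3h₂t) ≡ 2h₁t (mod 3)` degenerates, which shifts the critical-point
bookkeeping by one `3`-adic digit: if `3 ∤ h₁` there is no critical unit and `S = 0`; if `h₁ = 3h₁′` (`3 ∤ h₂`) the
critical congruence after the first step with `pᵇ` is `3^{b-1} ∣ 2h₁′ + h₂y` (one class, `card_filter_le_one_of_linear`).
* Odd `n = 2a+1 ≥ 3` (`cuspSum_firstStep_three_odd`, `norm_cuspSum_three_odd`): the first step is valid with
  `b = a + 1 > a` because the `z²`-coefficient `h₁ + 3h₂y` is divisible by `3`; one critical `y < 3ᵃ`, so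
  `|S| ≤ 3^{a+1} = √3·3^{n/2}`.
* Even `n = 2a ≥ 4` (`norm_sum_critical_class_three`): `b = a`, one critical class `u mod 3^{a-1}`, and along it the
  three lifts `u + 3^{a-1}w` give a quadratic Gauss sum modulo `3` (the cubic term is absorbed by `w³ ≡ w (mod 3)`),
  so `|S| ≤ √3·3^{a}`; `n = 2` is the trivial bound `φ(9) = 6 = 2·3`.
(Iwaniec–Kowalski 2004, §12.3, "stationary phase for prime powers", adapted to `p = 3`.)
-/

noncomputable section

-- `Summit.<Summit>.<Problem>` is the mandated summit-side namespace (CONVENTIONS §2); for the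
-- single-conjunct summit `ABC` the two coincide, so the duplicate `ABC.ABC` is deliberate.
set_option linter.dupNamespace false

namespace Summit.ABC.ABC.Theorems.SharpModerateLaw.CuspDispersion

open Finset
open Summit.ABC.ABC.Theorems.SharpModerateLaw.DeepModuli

/-! ## A. Generic additions to the `DeepModuli` toolkit -/

/-- The number of `t < pⁿ` prime to `p` is `φ(pⁿ) = p^{n-1}(p-1)`. [folklore] -/
theorem card_filter_coprime_prime_pow {p : ℕ} (hp : p.Prime) {n : ℕ} (hn : n ≠ 0) :
    ((Finset.range (p ^ n)).filter (fun t : ℕ => Nat.Coprime t p)).card = p ^ (n - 1) * (p - 1) := by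
  rw [← Nat.totient_prime_pow hp (Nat.pos_of_ne_zero hn), Nat.totient_eq_card_coprime]
  congr 1
  refine Finset.filter_congr (fun t _ => ?_)
  rw [Nat.coprime_comm, Nat.coprime_pow_left_iff (Nat.pos_of_ne_zero hn)]

/-- Trivial bound: a sum of values of an additive character over a finite set of naturals has norm at most
the number of terms. [folklore] -/
theorem norm_sum_stdAddChar_le_card {N : ℕ} [NeZero N] (s : Finset ℕ) (g : ℕ → ZMod N) :
    ‖∑ t ∈ s, ZMod.stdAddChar (g t)‖ ≤ s.card := by
  refine (norm_sum_le _ _).trans ?_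
  simp only [AddChar.norm_apply, Finset.sum_const, nsmul_eq_mul, mul_one, le_refl]

/-- Reindexing a filtered sum over `range (A·B)` by `t = y + Az` when the filter is `A`-periodic. [folklore] -/
theorem sum_filter_range_mul {M : Type*} [AddCommMonoid M] (F : ℕ → M) (A B : ℕ) (P : ℕ → Prop)
    [DecidablePred P] (hP : ∀ y z : ℕ, P (y + A * z) ↔ P y) :
    ∑ t ∈ (Finset.range (A * B)).filter P, F t =
      ∑ y ∈ (Finset.range A).filter P, ∑ z ∈ Finset.range B, F (y + A * z) := by
  simp only [Finset.sum_filter]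
  rw [sum_range_mul_eq_sum_sum _ A B]
  refine Finset.sum_congr rfl (fun y _ => ?_)
  simp only [hP]
  by_cases hy : P y
  · simp only [if_pos hy]
  · simp only [if_neg hy, Finset.sum_const_zero]

/-- **At most one critical class, linear form.** If `(L, K)` are not both divisible by the prime `p`, at most
one `u < pᵉ` in any subfamily satisfies `pᵉ ∣ L + Ku` (two solutions differ by a multiple of `pᵉ`, `K` being then
a unit mod `p`; for `e = 0` the range is a singleton). [folklore] -/
theorem card_filter_le_one_of_linear {p : ℕ} (hp : p.Prime) {L K : ℤ} (hLK : ¬ ((p : ℤ) ∣ L ∧ (p : ℤ) ∣ K))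
    (e : ℕ) (R : ℕ → Prop) [DecidablePred R] (hR : ∀ u : ℕ, R u → (p : ℤ) ^ e ∣ L + K * u) :
    ((Finset.range (p ^ e)).filter R).card ≤ 1 := by
  rw [Finset.card_le_one]
  intro u hu u' hu'
  rw [Finset.mem_filter, Finset.mem_range] at hu hu'
  obtain ⟨hult, hRu⟩ := hu
  obtain ⟨hu'lt, hRu'⟩ := hu'
  rcases Nat.eq_zero_or_pos e with rfl | he
  · rw [pow_zero] at hult hu'lt
    omega
  have hud := hR u hRu
  have hu'd := hR u' hRu'
  have hpZ : Prime (p : ℤ) := Nat.prime_iff_prime_int.mp hp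
  have hK : ¬ (p : ℤ) ∣ K := by
    intro hK
    refine hLK ⟨?_, hK⟩
    have h1 : (p : ℤ) ∣ L + K * u := (dvd_pow_self (p : ℤ) he.ne').trans hud
    have h2 : (p : ℤ) ∣ (L + K * u) - K * u := dvd_sub h1 (dvd_mul_of_dvd_left hK _)
    simpa using h2
  have hcop : IsCoprime ((p : ℤ) ^ e) K :=
    IsCoprime.pow_left ((Prime.coprime_iff_not_dvd hpZ).mpr hK)
  have hdiff : (p : ℤ) ^ e ∣ K * ((u : ℤ) - u') := by
    rw [show K * ((u : ℤ) - u') = (L + K * u) - (L + K * u') by ring]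
    exact dvd_sub hud hu'd
  have hy1 : (u : ℤ) < (p : ℤ) ^ e := by exact_mod_cast hult
  have hy2 : (u' : ℤ) < (p : ℤ) ^ e := by exact_mod_cast hu'lt
  have hy0 : (0 : ℤ) ≤ u := Nat.cast_nonneg u
  have hy0' : (0 : ℤ) ≤ u' := Nat.cast_nonneg u'
  have h0 := Int.eq_zero_of_abs_lt_dvd (hcop.dvd_of_dvd_mul_left hdiff)
    (abs_sub_lt_iff.mpr ⟨by linarith, by linarith⟩)
  omega

/-- If no unit `y` satisfies `p ∣ 2h₁ + 3h₂y`, the cusp sum to modulus `p^{m+1}` vanishes (first step with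
`b = 1`). [folklore] -/
theorem cuspSum_eq_zero_of_no_critical {p : ℕ} [Fact p.Prime] (h₁ h₂ : ℤ) {m : ℕ} (hm : m ≠ 0)
    (H : ∀ y : ℕ, Nat.Coprime y p → ¬ (p : ℤ) ∣ 2 * h₁ + 3 * h₂ * y) :
    ∑ t ∈ (Finset.range (p ^ (m + 1))).filter (fun t : ℕ => Nat.Coprime t p),
        ZMod.stdAddChar (N := p ^ (m + 1)) ((h₁ * t ^ 2 + h₂ * t ^ 3 : ℤ) : ZMod (p ^ (m + 1))) = 0 := by
  rw [cuspSum_firstStep h₁ h₂ (a := m) (b := 1) (Nat.one_le_iff_ne_zero.mpr hm) one_ne_zero,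
    Finset.sum_eq_zero (fun y hy => ?_), mul_zero]
  obtain ⟨-, hcop, hdiv⟩ := Finset.mem_filter.mp hy
  exact absurd (by simpa using hdiv) (H y hcop)

/-- `w³ ≡ w (mod 3)` (Fermat). [folklore] -/
theorem three_dvd_pow_three_sub (w : ℕ) : (3 : ℤ) ∣ (w : ℤ) ^ 3 - w := by
  have h := (ZMod.intCast_zmod_eq_zero_iff_dvd ((w : ℤ) ^ 3 - w) 3).mp (by
    push_cast
    rw [ZMod.pow_card, sub_self])
  exact_mod_cast h

/-! ## B. The prime `p = 3` -/

/-- **First step at `p = 3`, odd exponent `n = 2a+1`, `3 ∣ h₁`.** Substituting `t = y + 3ᵃz` (`y < 3ᵃ`,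
`z < 3^{a+1}`): `f(y + 3ᵃz) ≡ f(y) + 3ᵃ z f′(y) (mod 3^{2a+1})`, because the `z²`-coefficient `3^{2a}(h₁ + 3h₂y)` is
divisible by `3^{2a+1}` and `3a ≥ 2a+1`; orthogonality in `z` then gives
`S = 3^{a+1} · Σ_{y<3ᵃ unit, 3^{a+1} ∣ 2h₁+3h₂y} e(f(y)/3ⁿ)` — one digit deeper than the generic first step.
(Iwaniec–Kowalski 2004, §12.3, adapted to `p = 3`.) -/
theorem cuspSum_firstStep_three_odd {h₁ : ℤ} (hh₁ : (3 : ℤ) ∣ h₁) (h₂ : ℤ) {a : ℕ} (ha : a ≠ 0) :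
    ∑ t ∈ (Finset.range (3 ^ (a + (a + 1)))).filter (fun t : ℕ => Nat.Coprime t 3),
        ZMod.stdAddChar (N := 3 ^ (a + (a + 1))) ((h₁ * t ^ 2 + h₂ * t ^ 3 : ℤ) : ZMod (3 ^ (a + (a + 1))))
      = (3 : ℂ) ^ (a + 1) * ∑ y ∈ (Finset.range (3 ^ a)).filter
          (fun y : ℕ => Nat.Coprime y 3 ∧ (3 : ℤ) ^ (a + 1) ∣ 2 * h₁ + 3 * h₂ * y),
            ZMod.stdAddChar (N := 3 ^ (a + (a + 1))) ((h₁ * y ^ 2 + h₂ * y ^ 3 : ℤ) : ZMod (3 ^ (a + (a + 1)))) := by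
  classical
  obtain ⟨h₁', rfl⟩ := hh₁
  obtain ⟨a', rfl⟩ : ∃ a', a = a' + 1 := ⟨a - 1, by omega⟩
  -- pointwise splitting of the summand after the substitution `t = y + 3ᵃ z`
  have hsplit : ∀ y z : ℕ,
      ZMod.stdAddChar (N := 3 ^ (a' + 1 + (a' + 1 + 1)))
          ((3 * h₁' * ((y + 3 ^ (a' + 1) * z : ℕ) : ℤ) ^ 2 + h₂ * ((y + 3 ^ (a' + 1) * z : ℕ) : ℤ) ^ 3 : ℤ) :
            ZMod (3 ^ (a' + 1 + (a' + 1 + 1))))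
        = ZMod.stdAddChar (N := 3 ^ (a' + 1 + (a' + 1 + 1)))
            ((3 * h₁' * y ^ 2 + h₂ * y ^ 3 : ℤ) : ZMod (3 ^ (a' + 1 + (a' + 1 + 1)))) *
          ZMod.stdAddChar (N := 3 ^ (a' + 1 + 1))
            ((z * (y * (2 * (3 * h₁') + 3 * h₂ * y)) : ℤ) : ZMod (3 ^ (a' + 1 + 1))) := by
    intro y z
    have hsc : ZMod.stdAddChar (N := 3 ^ (a' + 1 + (a' + 1 + 1)))
        (((3 ^ (a' + 1) : ℕ) * (z * (y * (2 * (3 * h₁') + 3 * h₂ * y))) : ℤ) : ZMod (3 ^ (a' + 1 + (a' + 1 + 1))))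
        = ZMod.stdAddChar (N := 3 ^ (a' + 1 + 1))
            ((z * (y * (2 * (3 * h₁') + 3 * h₂ * y)) : ℤ) : ZMod (3 ^ (a' + 1 + 1))) :=
      stdAddChar_mul_eq (by ring) _
    rw [← hsc, ← AddChar.map_add_eq_mul, ← Int.cast_add]
    congr 1
    rw [ZMod.intCast_eq_intCast_iff_dvd_sub]
    refine ⟨-(z ^ 2 * (h₁' + h₂ * y) + 3 ^ a' * z ^ 3 * h₂), ?_⟩
    push_cast
    ring
  simp only [Finset.sum_filter]
  rw [Finset.mul_sum, show Finset.range (3 ^ (a' + 1 + (a' + 1 + 1))) =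
      Finset.range (3 ^ (a' + 1) * 3 ^ (a' + 1 + 1)) by rw [← pow_add],
    sum_range_mul_eq_sum_sum _ (3 ^ (a' + 1)) (3 ^ (a' + 1 + 1))]
  refine Finset.sum_congr rfl (fun y _ => ?_)
  simp only [coprime_add_pow_mul_iff (Nat.succ_ne_zero a'), hsplit]
  by_cases hy : Nat.Coprime y 3
  · simp only [if_pos hy]
    rw [← Finset.mul_sum, sum_range_stdAddChar_mul (3 ^ (a' + 1 + 1)) (y * (2 * (3 * h₁') + 3 * h₂ * y))]
    have hcop : IsCoprime ((3 : ℤ) ^ (a' + 1 + 1)) (y : ℤ) := by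
      have h1 : Nat.Coprime (3 ^ (a' + 1 + 1)) y := Nat.Coprime.pow_left _ (Nat.coprime_comm.mp hy)
      exact_mod_cast Nat.isCoprime_iff_coprime.mpr h1
    have hdvd : ((3 ^ (a' + 1 + 1) : ℕ) : ℤ) ∣ y * (2 * (3 * h₁') + 3 * h₂ * y) ↔
        (3 : ℤ) ^ (a' + 1 + 1) ∣ 2 * (3 * h₁') + 3 * h₂ * y := by
      push_cast
      exact ⟨fun h => hcop.dvd_of_dvd_mul_left h, fun h => h.mul_left _⟩
    by_cases hL : (3 : ℤ) ^ (a' + 1 + 1) ∣ 2 * (3 * h₁') + 3 * h₂ * y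
    · rw [if_pos (hdvd.mpr hL), if_pos ⟨hy, hL⟩, mul_comm]
      push_cast
      ring
    · rw [if_neg (mt hdvd.mp hL), if_neg (fun h => hL h.2), mul_zero, mul_zero]
  · simp only [hy, false_and, if_false, Finset.sum_const_zero, mul_zero]

/-- `p = 3`, `h₁ = 3h₁′`, `3 ∤ h₂`, odd exponent `n = 2a + 1 ≥ 3`: `|S| ≤ 3^{a+1}` — by `cuspSum_firstStep_three_odd`
and the fact that at most one `y < 3ᵃ` has `3ᵃ ∣ 2h₁′ + h₂y` (`card_filter_le_one_of_linear`). -/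
theorem norm_cuspSum_three_odd (h₁' : ℤ) {h₂ : ℤ} (hh₂ : ¬ (3 : ℤ) ∣ h₂) {a : ℕ} (ha : a ≠ 0) :
    ‖∑ t ∈ (Finset.range (3 ^ (a + (a + 1)))).filter (fun t : ℕ => Nat.Coprime t 3),
        ZMod.stdAddChar (N := 3 ^ (a + (a + 1)))
          ((3 * h₁' * t ^ 2 + h₂ * t ^ 3 : ℤ) : ZMod (3 ^ (a + (a + 1))))‖ ≤ (3 : ℝ) ^ (a + 1) := by
  rw [cuspSum_firstStep_three_odd (dvd_mul_right 3 h₁') h₂ ha, norm_mul, norm_pow, Complex.norm_ofNat]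
  have hcard : ((Finset.range (3 ^ a)).filter (fun y : ℕ => Nat.Coprime y 3 ∧
      (3 : ℤ) ^ (a + 1) ∣ 2 * (3 * h₁') + 3 * h₂ * y)).card ≤ 1 := by
    refine card_filter_le_one_of_linear Nat.prime_three (L := 2 * h₁') (K := h₂)
      (fun h => hh₂ (by exact_mod_cast h.2)) a _ (fun u hu => ?_)
    have h := hu.2
    rw [pow_succ, show 2 * (3 * h₁') + 3 * h₂ * (u : ℤ) = (2 * h₁' + h₂ * u) * 3 by ring] at h
    exact_mod_cast (mul_dvd_mul_iff_right (by norm_num : (3 : ℤ) ≠ 0)).mp h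
  have hT := norm_sum_stdAddChar_le_card ((Finset.range (3 ^ a)).filter (fun y : ℕ => Nat.Coprime y 3 ∧
      (3 : ℤ) ^ (a + 1) ∣ 2 * (3 * h₁') + 3 * h₂ * y))
    (fun y : ℕ => ((3 * h₁' * y ^ 2 + h₂ * y ^ 3 : ℤ) : ZMod (3 ^ (a + (a + 1)))))
  have h1 : (((Finset.range (3 ^ a)).filter (fun y : ℕ => Nat.Coprime y 3 ∧
      (3 : ℤ) ^ (a + 1) ∣ 2 * (3 * h₁') + 3 * h₂ * y)).card : ℝ) ≤ 1 := by
    exact_mod_cast hcard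
  have h3 : (0 : ℝ) ≤ (3 : ℝ) ^ (a + 1) := by positivity
  nlinarith [hT.trans h1]

/-- **Second step at `p = 3`, even exponent `n = 2a`, `a = e + 2 ≥ 2`, `h₁ = 3h₁′`, `3 ∤ h₂`.** Along the critical
class `y = u + 3^{a-1}w`, `w < 3` (`u` a unit with `3^{a-1} ∣ 2h₁′ + h₂u = 3^{a-1}κ`):
`f(u + 3^{a-1}w) ≡ f(u) + 3^{2a-1}(c w² + ℓ w) (mod 3^{2a})` with `c = h₁′ + h₂u` prime to `3` and
`ℓ = uκ + 3^{a-2}h₂` (the cubic term `3^{3a-3}h₂w³` is absorbed into `ℓ` through `w³ ≡ w (mod 3)`), so the `w`-sum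
is a unimodular factor times a quadratic Gauss sum modulo `3`, of modulus `√3`. (Iwaniec–Kowalski 2004, §12.3,
adapted to `p = 3`.) -/
theorem norm_sum_critical_class_three {h₁' h₂ : ℤ} (hh₂ : ¬ (3 : ℤ) ∣ h₂) (e : ℕ) {u : ℕ}
    (hu : Nat.Coprime u 3) (hdiv : (3 : ℤ) ^ (e + 1) ∣ 2 * h₁' + h₂ * u) :
    ‖∑ w ∈ Finset.range 3, ZMod.stdAddChar (N := 3 ^ (e + 2 + (e + 2)))
        ((3 * h₁' * ((u + 3 ^ (e + 1) * w : ℕ) : ℤ) ^ 2 + h₂ * ((u + 3 ^ (e + 1) * w : ℕ) : ℤ) ^ 3 : ℤ) :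
          ZMod (3 ^ (e + 2 + (e + 2))))‖ = Real.sqrt 3 := by
  obtain ⟨κ, hκ⟩ := hdiv
  -- `c = h₁' + h₂u` is prime to `3`
  have hc : ¬ (3 : ℤ) ∣ h₁' + h₂ * u := by
    intro hc
    have h3 : (3 : ℤ) ∣ 2 * h₁' + h₂ * u := (dvd_pow_self (3 : ℤ) (Nat.succ_ne_zero e)).trans ⟨κ, hκ⟩
    have hh₁' : (3 : ℤ) ∣ h₁' := by
      have h := dvd_sub h3 hc
      rwa [show 2 * h₁' + h₂ * u - (h₁' + h₂ * u) = h₁' by ring] at h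
    have hu3 : (3 : ℤ) ∣ h₂ * u := by
      have h := dvd_sub hc hh₁'
      rwa [show h₁' + h₂ * u - h₁' = h₂ * u by ring] at h
    rcases Int.prime_three.dvd_or_dvd hu3 with h | h
    · exact hh₂ h
    · have h' : (3 : ℕ) ∣ u := by exact_mod_cast h
      exact (Nat.Prime.coprime_iff_not_dvd Nat.prime_three).mp (Nat.coprime_comm.mp hu) h'
  -- pointwise factorisation along the class
  have hfac : ∀ w : ℕ, ZMod.stdAddChar (N := 3 ^ (e + 2 + (e + 2)))
      ((3 * h₁' * ((u + 3 ^ (e + 1) * w : ℕ) : ℤ) ^ 2 + h₂ * ((u + 3 ^ (e + 1) * w : ℕ) : ℤ) ^ 3 : ℤ) :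
        ZMod (3 ^ (e + 2 + (e + 2))))
      = ZMod.stdAddChar (N := 3 ^ (e + 2 + (e + 2)))
          ((3 * h₁' * u ^ 2 + h₂ * u ^ 3 : ℤ) : ZMod (3 ^ (e + 2 + (e + 2)))) *
        ZMod.stdAddChar (N := 3)
          ((((h₁' + h₂ * u) * w ^ 2 + (u * κ + 3 ^ e * h₂) * w) : ℤ) : ZMod 3) := by
    intro w
    have hsc : ZMod.stdAddChar (N := 3 ^ (e + 2 + (e + 2)))
        (((3 ^ (e + 2 + (e + 1)) : ℕ) * ((h₁' + h₂ * u) * w ^ 2 + (u * κ + 3 ^ e * h₂) * w) : ℤ) :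
          ZMod (3 ^ (e + 2 + (e + 2))))
        = ZMod.stdAddChar (N := 3) ((((h₁' + h₂ * u) * w ^ 2 + (u * κ + 3 ^ e * h₂) * w) : ℤ) : ZMod 3) :=
      stdAddChar_mul_eq (by ring) _
    obtain ⟨q, hq⟩ := three_dvd_pow_three_sub w
    rw [← hsc, ← AddChar.map_add_eq_mul, ← Int.cast_add]
    congr 1
    rw [ZMod.intCast_eq_intCast_iff_dvd_sub]
    refine ⟨-(3 ^ e * h₂ * q), ?_⟩
    push_cast
    linear_combination (-(3 : ℤ) ^ (e + 2) * w * u) * hκ + (-(3 : ℤ) ^ (3 * e + 3) * h₂) * hq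
  simp_rw [hfac]
  rw [← Finset.mul_sum, norm_mul, AddChar.norm_apply, one_mul]
  have h := norm_sum_range_quadratic (p := 3) (by norm_num) (c := h₁' + h₂ * u) (by exact_mod_cast hc)
    (u * κ + 3 ^ e * h₂)
  simpa using h

/-- **The cusp sum at `p = 3`.** For `n ≥ 2` and `(h₁, h₂)` not both divisible by `3`, `|S(h₁,h₂;3ⁿ)| ≤ 2·3^{n/2}`:
`S = 0` if `3 ∤ h₁` (no critical unit); otherwise `|S| ≤ √3·3^{n/2}` by `norm_cuspSum_three_odd` (odd `n`) and by the
first step with `b = a` plus `norm_sum_critical_class_three` along the unique critical class (even `n ≥ 4`);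
`n = 2` is the trivial bound `φ(9) = 6`. -/
theorem norm_cuspSum_three_le {n : ℕ} (hn : 2 ≤ n) (h₁ h₂ : ℤ) (hnot : ¬ ((3 : ℤ) ∣ h₁ ∧ (3 : ℤ) ∣ h₂)) :
    ‖∑ t ∈ (Finset.range (3 ^ n)).filter (fun t : ℕ => Nat.Coprime t 3),
        ZMod.stdAddChar (N := 3 ^ n) ((h₁ * t ^ 2 + h₂ * t ^ 3 : ℤ) : ZMod (3 ^ n))‖
      ≤ 2 * (3 : ℝ) ^ ((n : ℝ) / 2) := by
  have hpos : (0 : ℝ) ≤ 2 * (3 : ℝ) ^ ((n : ℝ) / 2) := by positivity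
  by_cases hh₁ : (3 : ℤ) ∣ h₁
  swap
  · -- no critical unit: `S = 0`
    obtain ⟨m, rfl⟩ : ∃ m, n = m + 1 := ⟨n - 1, by omega⟩
    rw [cuspSum_eq_zero_of_no_critical h₁ h₂ (by omega) (fun y _ h => hh₁ ?_), norm_zero]
    · exact hpos
    have h' : (3 : ℤ) ∣ 2 * h₁ + 3 * h₂ * y := by exact_mod_cast h
    have h'' : (3 : ℤ) ∣ 2 * h₁ := by
      have h2 := dvd_sub h' (dvd_mul_of_dvd_left (dvd_mul_right 3 h₂) (y : ℤ))
      rwa [add_sub_cancel_right] at h2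
    rcases Int.prime_three.dvd_or_dvd h'' with h3 | h3
    · norm_num at h3
    · exact h3
  obtain ⟨h₁', rfl⟩ := hh₁
  have hh₂ : ¬ (3 : ℤ) ∣ h₂ := fun h => hnot ⟨dvd_mul_right 3 h₁', h⟩
  rcases Nat.even_or_odd' n with ⟨a, rfl | rfl⟩
  · -- even exponent `n = 2a`
    have hexp : (3 : ℝ) ^ (((2 * a : ℕ) : ℝ) / 2) = (3 : ℝ) ^ a := by
      rw [show ((2 * a : ℕ) : ℝ) / 2 = (a : ℝ) by push_cast; ring, Real.rpow_natCast]
    rw [hexp]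
    rcases Nat.lt_or_ge a 2 with ha2 | ha2
    · -- `n = 2`: trivial bound
      obtain rfl : a = 1 := by omega
      refine (norm_sum_stdAddChar_le_card _ _).trans ?_
      rw [card_filter_coprime_prime_pow Nat.prime_three (by norm_num)]
      norm_num
    obtain ⟨e, rfl⟩ : ∃ e, a = e + 2 := ⟨a - 2, by omega⟩
    have hfirst := cuspSum_firstStep (p := 3) (3 * h₁') h₂ (a := e + 2) (b := e + 2) le_rfl (by omega)
    simp only [Nat.cast_ofNat] at hfirst
    rw [show 2 * (e + 2) = e + 2 + (e + 2) by ring, hfirst, norm_mul, norm_pow, Complex.norm_ofNat]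
    -- reindex the critical sum along `y = u + 3^{e+1} w`
    have hP : ∀ y w : ℕ, (Nat.Coprime (y + 3 ^ (e + 1) * w) 3 ∧
        (3 : ℤ) ^ (e + 2) ∣ 2 * (3 * h₁') + 3 * h₂ * ((y + 3 ^ (e + 1) * w : ℕ) : ℤ)) ↔
        (Nat.Coprime y 3 ∧ (3 : ℤ) ^ (e + 2) ∣ 2 * (3 * h₁') + 3 * h₂ * (y : ℤ)) := by
      intro y w
      rw [coprime_add_pow_mul_iff (Nat.succ_ne_zero e)]
      refine and_congr_right (fun _ => ?_)
      rw [show 2 * (3 * h₁') + 3 * h₂ * ((y + 3 ^ (e + 1) * w : ℕ) : ℤ) =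
          (3 : ℤ) ^ (e + 2) * (h₂ * w) + (2 * (3 * h₁') + 3 * h₂ * (y : ℤ)) by push_cast; ring]
      exact dvd_add_right (dvd_mul_right _ _)
    rw [show Finset.range (3 ^ (e + 2)) = Finset.range (3 ^ (e + 1) * 3) by rw [← pow_succ],
      sum_filter_range_mul _ (3 ^ (e + 1)) 3 _ hP]
    have hcard : ((Finset.range (3 ^ (e + 1))).filter (fun y : ℕ => Nat.Coprime y 3 ∧
        (3 : ℤ) ^ (e + 2) ∣ 2 * (3 * h₁') + 3 * h₂ * y)).card ≤ 1 := by
      refine card_filter_le_one_of_linear Nat.prime_three (L := 2 * h₁') (K := h₂)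
        (fun h => hh₂ (by exact_mod_cast h.2)) (e + 1) _ (fun u hu => ?_)
      have h := hu.2
      rw [pow_succ, show 2 * (3 * h₁') + 3 * h₂ * (u : ℤ) = (2 * h₁' + h₂ * u) * 3 by ring] at h
      exact_mod_cast (mul_dvd_mul_iff_right (by norm_num : (3 : ℤ) ≠ 0)).mp h
    have hT : ‖∑ u ∈ (Finset.range (3 ^ (e + 1))).filter (fun y : ℕ => Nat.Coprime y 3 ∧
          (3 : ℤ) ^ (e + 2) ∣ 2 * (3 * h₁') + 3 * h₂ * y),
          ∑ w ∈ Finset.range 3, ZMod.stdAddChar (N := 3 ^ (e + 2 + (e + 2)))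
            ((3 * h₁' * ((u + 3 ^ (e + 1) * w : ℕ) : ℤ) ^ 2 + h₂ * ((u + 3 ^ (e + 1) * w : ℕ) : ℤ) ^ 3 : ℤ) :
              ZMod (3 ^ (e + 2 + (e + 2))))‖ ≤ Real.sqrt 3 := by
      refine (norm_sum_le _ _).trans ?_
      have hpt : ∀ u ∈ (Finset.range (3 ^ (e + 1))).filter (fun y : ℕ => Nat.Coprime y 3 ∧
          (3 : ℤ) ^ (e + 2) ∣ 2 * (3 * h₁') + 3 * h₂ * y),
          ‖∑ w ∈ Finset.range 3, ZMod.stdAddChar (N := 3 ^ (e + 2 + (e + 2)))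
            ((3 * h₁' * ((u + 3 ^ (e + 1) * w : ℕ) : ℤ) ^ 2 + h₂ * ((u + 3 ^ (e + 1) * w : ℕ) : ℤ) ^ 3 : ℤ) :
              ZMod (3 ^ (e + 2 + (e + 2))))‖ = Real.sqrt 3 := by
        intro u hu
        obtain ⟨-, hcop, hdiv⟩ := Finset.mem_filter.mp hu
        rw [pow_succ, show 2 * (3 * h₁') + 3 * h₂ * (u : ℤ) = (2 * h₁' + h₂ * u) * 3 by ring] at hdiv
        exact norm_sum_critical_class_three hh₂ e hcop
          ((mul_dvd_mul_iff_right (by norm_num : (3 : ℤ) ≠ 0)).mp hdiv)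
      rw [Finset.sum_congr rfl hpt, Finset.sum_const, nsmul_eq_mul]
      have hs : (0 : ℝ) ≤ Real.sqrt 3 := Real.sqrt_nonneg _
      have hc1 : (((Finset.range (3 ^ (e + 1))).filter (fun y : ℕ => Nat.Coprime y 3 ∧
          (3 : ℤ) ^ (e + 2) ∣ 2 * (3 * h₁') + 3 * h₂ * y)).card : ℝ) ≤ 1 := by
        exact_mod_cast hcard
      nlinarith
    have hs3 : Real.sqrt 3 ≤ 2 := by
      rw [Real.sqrt_le_left (by norm_num)]
      norm_num
    have h3 : (0 : ℝ) ≤ (3 : ℝ) ^ (e + 2) := by positivity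
    nlinarith [mul_le_mul_of_nonneg_left (hT.trans hs3) h3]
  · -- odd exponent `n = 2a + 1`
    have ha : a ≠ 0 := by omega
    have hexp : (3 : ℝ) ^ (((2 * a + 1 : ℕ) : ℝ) / 2) = (3 : ℝ) ^ a * Real.sqrt 3 := by
      rw [show ((2 * a + 1 : ℕ) : ℝ) / 2 = (a : ℝ) + 1 / 2 by push_cast; ring,
        Real.rpow_add (by norm_num : (0 : ℝ) < 3), Real.rpow_natCast, Real.sqrt_eq_rpow]
    rw [hexp, show 2 * a + 1 = a + (a + 1) by ring]
    refine (norm_cuspSum_three_odd h₁' hh₂ ha).trans ?_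
    have hs : (0 : ℝ) ≤ Real.sqrt 3 := Real.sqrt_nonneg _
    have hs2 : Real.sqrt 3 ^ 2 = 3 := Real.sq_sqrt (by norm_num)
    have h3 : (0 : ℝ) ≤ (3 : ℝ) ^ a := by positivity
    have h32 : (3 : ℝ) ≤ 2 * Real.sqrt 3 := by nlinarith
    calc (3 : ℝ) ^ (a + 1) = (3 : ℝ) ^ a * 3 := pow_succ _ _
      _ ≤ (3 : ℝ) ^ a * (2 * Real.sqrt 3) := mul_le_mul_of_nonneg_left h32 h3
      _ = 2 * ((3 : ℝ) ^ a * Real.sqrt 3) := by ring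

/-- **Registered sub-goal `cuspSumBound23_three_main`** of stmt-ABC-1975 (support 1/2 of `stub_cuspStationaryPhase23`,
line `deep-moduli-cusp-dispersion`): the `p = 3` half of `CuspSumBound23` in `ZMod.stdAddChar` form — for `n ≥ 2` and
`(h₁, h₂)` not both divisible by `3`, `|Σ_{t<3ⁿ, 3∤t} e((h₁t² + h₂t³)/3ⁿ)| ≤ 2·3^{n/2}` (`norm_cuspSum_three_le`). -/
theorem cuspSumBound23_three_main : ∀ n : ℕ, 2 ≤ n → ∀ h₁ h₂ : ℤ, ¬ ((3 : ℤ) ∣ h₁ ∧ (3 : ℤ) ∣ h₂) → ‖∑ t ∈ (Finset.range (3 ^ n)).filter (fun t : ℕ => Nat.Coprime t 3), ZMod.stdAddChar (N := 3 ^ n) ((h₁ * t ^ 2 + h₂ * t ^ 3 : ℤ) : ZMod (3 ^ n))‖ ≤ 2 * (3 : ℝ) ^ ((n : ℝ) / 2) :=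
  fun _ hn h₁ h₂ hnot => norm_cuspSum_three_le hn h₁ h₂ hnot

end Summit.ABC.ABC.Theorems.SharpModerateLaw.CuspDispersion

end
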